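import Literature.Probability.RandomPlanarGeometry.ConformalRectangleProofs
import HarnessLib

/-!
# Stub `stub_boundaryCorrespondence` of line `excursion-kernel-covariance`
# (crux `RectilinearCardy`, stmt-CriticalPhenomena-5660, route `CardyBoundaryCoulombGas`)

Boundary correspondence with inverse extension. Every conformal rectangle `R = (Ω; a, b, c, d)`
admits a uniformizer `φ : ℍₒ → Ω`, a real boundary correspondence `g`, continuous and strictly
monotone-or-antitone on a parameter interval `[S₀, S] ⊋ [0, mark 3]` (`S₀ < 0`, `mark 3 < S < 1`,
`S < S₀ + 1`), with `φ → ∂Ω(t)` at `g t` for every `t ∈ [S₀, S]`, together with an extension `w₀`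
of `φ⁻¹` continuous on `Ω ∪ ∂Ω([S₀, S])` and taking the real value `g t` at `∂Ω(t)`.

Proof (the construction of the tree's `MarkedDomain.exists_isUniformizing_of_disc`, Pommerenke
(1992), proof of Cor. 2.7, keeping the inverse of the Carathéodory homeomorphism). Let
`ψ : Ω → 𝔻` be a Riemann map (`exists_conformalEquiv_ball_holds`), `Ψ : 𝔻̄ → Ω̄` the Carathéodory
homeomorphism extending `ψ⁻¹` (`JordanDomain.exists_continuousOn_extension_holds`, Pommerenke's
Thm. 2.6) and `Φ = Ψ⁻¹ : Ω̄ → 𝔻̄`, continuous (`continuousOn_invFunOn_of_isCompact`), equal to `ψ`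
on `Ω` and of modulus one on `∂Ω`. Choose parameters `mark 3 < S < t₁ < S₀ + 1 < 1`, `S₀ < 0`;
the boundary loop is injective on the period `[S₀, S₀ + 1) ⊇ [S₀, S] ∪ {t₁}`
(`JordanDomain.injOn_boundary_Ico`), so `p₁ = ∂Ω(t₁) ∉ ∂Ω([S₀, S])`. With `η = Φ p₁`,
`φ = ψ⁻¹ ∘ (η ·) ∘ cayley` sends `∞ ↦ p₁`, `w₀ = cayley⁻¹ ∘ (η⁻¹ ·) ∘ Φ` inverts it on `Ω`, is
continuous on `Ω̄ ∖ {p₁}` (the inverse Cayley map is continuous off `1`), and on `∂Ω` its value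
`w₀(∂Ω(t)) = cayley⁻¹(unit number) = g t` is real (`cayleyInvFun_eq_ofReal_re`); `g` is continuous
and injective on `[S₀, S]`, hence strictly monotone or antitone
(`ContinuousOn.strictMonoOn_of_injOn_Icc'`), and `φ → Ψ (η · cayleyFun (g t)) = ∂Ω(t)` at `g t`
(`JordanDomain.tendsto_nhdsWithin_of_extension`).
-/

noncomputable section

open Set Filter Topology Metric
open UpperHalfPlane (upperHalfPlaneSet)

namespace Summit.CriticalPhenomena.CardyFormulaZ2.Cruxes.RectilinearCardy.ExcursionKernelCovariance

open Literature.Probability.RandomPlanarGeometry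

/-- **Boundary correspondence with inverse extension** (stub 6 of line
`excursion-kernel-covariance`). Every conformal rectangle `R` has a uniformizer `φ : ℍₒ → Ω`, a real
boundary correspondence `g`, continuous and strictly monotone-or-antitone on a parameter interval
`[S₀, S] ⊋ [0, mark 3]` (`S₀ < 0`, `mark 3 < S < 1`, `S < S₀ + 1`), with `φ` having boundary value
`∂Ω(t)` at `g t` for every `t ∈ [S₀, S]`, and an extension `w₀` of `φ⁻¹`, continuous on
`Ω ∪ ∂Ω([S₀, S])`, with `w₀ (∂Ω(t)) = g t` there. Riemann map + Carathéodory homeomorphism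
(`JordanDomain.exists_continuousOn_extension_holds`) + a boundary point `p₁ = ∂Ω(t₁)`,
`t₁ ∈ (S, S₀ + 1)`, sent to `∞` + Cayley; `w₀ = cayley⁻¹ ∘ (rotation) ∘ Ψ⁻¹`. Pommerenke,
*Boundary Behaviour of Conformal Maps* (1992), Thm. 2.6 and proof of Cor. 2.7.
[cite: PommerenkeBBCM1992, Thm. 2.6 and Cor. 2.7] -/
theorem stub_boundaryCorrespondence :
    ∀ R : ConformalRectangle,
      ∃ (φ : ConformalEquiv upperHalfPlaneSet R.carrier) (g : ℝ → ℝ) (S₀ S : ℝ) (w₀ : ℂ → ℂ),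
        S₀ < 0 ∧ R.mark 3 < S ∧ S < 1 ∧ S < S₀ + 1 ∧
        ContinuousOn g (Icc S₀ S) ∧ (StrictMonoOn g (Icc S₀ S) ∨ StrictAntiOn g (Icc S₀ S)) ∧
        (∀ t ∈ Icc S₀ S, φ.HasBoundaryValue (g t) (R.boundary t)) ∧
        EqOn w₀ φ.symm R.carrier ∧ ContinuousOn w₀ (R.carrier ∪ R.boundary '' Icc S₀ S) ∧
        ∀ t ∈ Icc S₀ S, w₀ (R.boundary t) = g t := by
  intro R
  -- Riemann map `ψ : Ω → 𝔻` and the Carathéodory homeomorphism `Ψ : 𝔻̄ → Ω̄` extending `ψ⁻¹`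
  have hsc : IsSimplyConnected R.carrier :=
    Complex.isSimplyConnected_of_isPreconnected_frontier R.isOpen R.isConnected R.isBounded
      (R.range_boundary ▸ isPreconnected_range R.continuous_boundary)
  obtain ⟨ψ⟩ := (exists_conformalEquiv_ball_holds (U := R.carrier)) R.isOpen hsc R.carrier_ne_univ
  obtain ⟨Ψ, hΨc, hΨeq, hball, hsph⟩ :=
    JordanDomain.exists_continuousOn_extension_holds R.toJordanDomain ψ.symm
  -- the inverse homeomorphism `Φ : Ω̄ → 𝔻̄`: continuous, `= ψ` on `Ω`, unimodular on `∂Ω`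
  set Φ : ℂ → ℂ := Function.invFunOn Ψ (closedBall 0 1) with hΦdef
  have hΨΦ : ∀ p ∈ closure R.carrier, Ψ (Φ p) = p := fun p hp ↦ hball.invOn_invFunOn.2 hp
  have hΦΨ : ∀ z ∈ closedBall (0 : ℂ) 1, Φ (Ψ z) = z := fun z hz ↦ hball.invOn_invFunOn.1 hz
  have hΦc : ContinuousOn Φ (closure R.carrier) :=
    continuousOn_invFunOn_of_isCompact (isCompact_closedBall 0 1) hΨc hball
  have hfc : frontier R.carrier ⊆ closure R.carrier := frontier_subset_closure
  have hΦ1 : ∀ p ∈ frontier R.carrier, ‖Φ p‖ = 1 := by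
    intro p hp
    obtain ⟨z, hz, rfl⟩ := hsph.surjOn hp
    rw [hΦΨ z (sphere_subset_closedBall hz)]
    exact mem_sphere_zero_iff_norm.1 hz
  have hΦψ : ∀ z ∈ R.carrier, Φ z = ψ z := by
    intro z hz
    have h1 : ψ z ∈ ball (0 : ℂ) 1 := ψ.mapsTo hz
    have h2 : Ψ (ψ z) = z := by rw [hΨeq h1, ψ.symm_apply_apply hz]
    calc Φ z = Φ (Ψ (ψ z)) := by rw [h2]
      _ = ψ z := hΦΨ _ (ball_subset_closedBall h1)
  -- parameters `S₀ < 0 ≤ mark 0 < ⋯ < mark 3 < S < t₁ < S₀ + 1 < 1`; `p₁ = ∂Ω(t₁)` is sent to `∞`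
  obtain ⟨S, h3S, hS1⟩ : ∃ S : ℝ, R.mark 3 < S ∧ S < 1 :=
    ⟨(R.mark 3 + 1) / 2, by linarith [(R.mark_mem 3).2], by linarith [(R.mark_mem 3).2]⟩
  have hS0 : 0 ≤ S := (R.mark_mem 3).1.trans h3S.le
  obtain ⟨t₁, hSt, ht1⟩ : ∃ t₁ : ℝ, S < t₁ ∧ t₁ < 1 := ⟨(S + 1) / 2, by linarith, by linarith⟩
  obtain ⟨S₀, hS₀0, ht₁S₀⟩ : ∃ S₀ : ℝ, S₀ < 0 ∧ t₁ < S₀ + 1 :=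
    ⟨(t₁ - 1) / 2, by linarith, by linarith⟩
  have hSS₀ : S < S₀ + 1 := hSt.trans ht₁S₀
  have ht₁I : t₁ ∈ Ico S₀ (S₀ + 1) := ⟨by linarith, ht₁S₀⟩
  have hIcc : Icc S₀ S ⊆ Ico S₀ (S₀ + 1) := fun t ht ↦ ⟨ht.1, ht.2.trans_lt hSS₀⟩
  have hinj : InjOn R.boundary (Ico S₀ (S₀ + 1)) := R.injOn_boundary_Ico S₀
  set p₁ : ℂ := R.boundary t₁ with hp₁
  have hp₁f : p₁ ∈ frontier R.carrier := R.boundary_mem_frontier t₁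
  -- boundary points with parameter in `[S₀, S]` are not `p₁`
  have hne : ∀ t ∈ Icc S₀ S, R.boundary t ≠ p₁ := by
    intro t ht h
    have hts : t = t₁ := hinj (hIcc ht) ht₁I h
    exact absurd (ht.2.trans_lt hSt) (by rw [hts]; exact lt_irrefl _)
  set η : ℂ := Φ p₁ with hη
  have hη1 : ‖η‖ = 1 := hΦ1 p₁ hp₁f
  have hη0 : η ≠ 0 := norm_ne_zero_iff.1 (by rw [hη1]; exact one_ne_zero)
  -- the rotated inverse Riemann map `ψ₂ = ψ⁻¹ ∘ (η ·)` and its extension `Ψ₂ = Ψ ∘ (η ·)`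
  set ψ₂ : ConformalEquiv (ball (0 : ℂ) 1) R.carrier := (rotBall η hη1).trans ψ.symm with hψ₂
  set Ψ₂ : ℂ → ℂ := fun w ↦ Ψ (η * w) with hΨ₂
  have hrot : MapsTo (fun w : ℂ ↦ η * w) (closedBall 0 1) (closedBall 0 1) := fun w hw ↦ by
    rw [mem_closedBall_zero_iff] at hw ⊢
    rwa [norm_mul, hη1, one_mul]
  have hΨ₂c : ContinuousOn Ψ₂ (closedBall 0 1) :=
    hΨc.comp (continuous_const_mul η).continuousOn hrot
  have hΨ₂eq : EqOn Ψ₂ ψ₂ (ball 0 1) := fun w hw ↦ hΨeq ((rotBall η hη1).mapsTo hw)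
  -- the uniformizing map `φ = ψ₂ ∘ cayley : ℍₒ → Ω`
  set φ : ConformalEquiv upperHalfPlaneSet R.carrier := cayley.trans ψ₂ with hφ
  have hΨ₂eq' : EqOn Ψ₂ (cayley.symm.trans φ) (ball 0 1) := fun w hw ↦ by
    rw [hΨ₂eq hw]
    change ψ₂ w = ψ₂ (cayley (cayley.symm w))
    rw [cayley.apply_symm_apply hw]
  -- the rotated circle preimage `w t` of `∂Ω(t)` and its real Cayley preimage `g t`
  set w : ℝ → ℂ := fun t ↦ η⁻¹ * Φ (R.boundary t) with hw
  set g : ℝ → ℝ := fun t ↦ (cayleyInvFun (w t)).re with hg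
  have hw1 : ∀ t, ‖w t‖ = 1 := fun t ↦ by
    rw [hw]
    simp only [norm_mul, norm_inv, hη1, hΦ1 _ (R.boundary_mem_frontier t), inv_one, one_mul]
  have hwne : ∀ t, R.boundary t ≠ p₁ → w t ≠ 1 := by
    intro t ht h1
    apply ht
    have h2 : Φ (R.boundary t) = η := by
      have : η * w t = η := by rw [h1, mul_one]
      rwa [hw, ← mul_assoc, mul_inv_cancel₀ hη0, one_mul] at this
    rw [← hΨΦ _ (hfc (R.boundary_mem_frontier t)), h2, hη, hΨΦ _ (hfc hp₁f)]
  have hcg : ∀ t, R.boundary t ≠ p₁ → cayleyFun (g t) = w t := fun t ht ↦ by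
    rw [hg, ← cayleyInvFun_eq_ofReal_re (hw1 t), cayleyFun_cayleyInvFun (hwne t ht)]
  have hΨ₂g : ∀ t, R.boundary t ≠ p₁ → Ψ₂ (cayleyFun (g t)) = R.boundary t := fun t ht ↦ by
    rw [hcg t ht, hΨ₂]
    change Ψ (η * (η⁻¹ * Φ (R.boundary t))) = R.boundary t
    rw [← mul_assoc, mul_inv_cancel₀ hη0, one_mul, hΨΦ _ (hfc (R.boundary_mem_frontier t))]
  -- `g` is continuous and injective, hence strictly monotone or antitone, on `[S₀, S]`
  have hgc : ContinuousOn g (Icc S₀ S) := by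
    have h1 : ContinuousOn (fun t ↦ Φ (R.boundary t)) (Icc S₀ S) :=
      hΦc.comp R.continuous_boundary.continuousOn fun t _ ↦ hfc (R.boundary_mem_frontier t)
    have h2 : ContinuousOn w (Icc S₀ S) := continuousOn_const.mul h1
    have h3 : ContinuousOn (fun t ↦ cayleyInvFun (w t)) (Icc S₀ S) :=
      differentiableOn_cayleyInvFun.continuousOn.comp h2 fun t ht ↦ hwne t (hne t ht)
    exact Complex.continuous_re.comp_continuousOn h3
  have hgi : InjOn g (Icc S₀ S) := by
    intro s hs t ht hst
    have h1 : w s = w t := by rw [← hcg s (hne s hs), ← hcg t (hne t ht), hst]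
    have h2 : Φ (R.boundary s) = Φ (R.boundary t) := mul_left_cancel₀ (inv_ne_zero hη0) h1
    have h3 : R.boundary s = R.boundary t := by
      rw [← hΨΦ _ (hfc (R.boundary_mem_frontier s)), h2,
        hΨΦ _ (hfc (R.boundary_mem_frontier t))]
    exact hinj (hIcc hs) (hIcc ht) h3
  have hgm : StrictMonoOn g (Icc S₀ S) ∨ StrictAntiOn g (Icc S₀ S) :=
    hgc.strictMonoOn_of_injOn_Icc' (hS₀0.le.trans hS0) hgi
  -- the inverse extension `w₀ = cayley⁻¹ ∘ (η⁻¹ ·) ∘ Φ`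
  set w₀ : ℂ → ℂ := fun z ↦ cayleyInvFun (η⁻¹ * Φ z) with hw₀
  refine ⟨φ, g, S₀, S, w₀, hS₀0, h3S, hS1, hSS₀, hgc, hgm, fun t ht ↦ ?_, fun z hz ↦ ?_, ?_,
    fun t _ ↦ ?_⟩
  · -- boundary value `∂Ω(t)` at `g t`
    have h1 : Tendsto φ (𝓝[upperHalfPlaneSet] (g t : ℂ)) (𝓝 (Ψ₂ (cayleyFun (g t)))) :=
      JordanDomain.tendsto_nhdsWithin_of_extension φ hΨ₂c hΨ₂eq' (by simp)
    rw [hΨ₂g _ (hne _ ht)] at h1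
    exact h1
  · -- `w₀ = φ⁻¹ = cayley⁻¹ ∘ (η⁻¹ ·) ∘ ψ` on `Ω`
    change cayleyInvFun (η⁻¹ * Φ z) = cayleyInvFun (η⁻¹ * ψ z)
    rw [hΦψ z hz]
  · -- continuity of `w₀` on `Ω ∪ ∂Ω([S₀, S])`: there `η⁻¹ Φ ≠ 1`
    have hsub : R.carrier ∪ R.boundary '' Icc S₀ S ⊆ closure R.carrier :=
      union_subset subset_closure
        (image_subset_iff.2 fun t _ ↦ hfc (R.boundary_mem_frontier t))
    have h1 : ContinuousOn (fun z ↦ η⁻¹ * Φ z) (R.carrier ∪ R.boundary '' Icc S₀ S) :=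
      continuousOn_const.mul (hΦc.mono hsub)
    refine differentiableOn_cayleyInvFun.continuousOn.comp h1 fun z hz ↦ ?_
    rcases hz with hz | ⟨t, ht, rfl⟩
    · -- interior points are sent into the open disc
      change η⁻¹ * Φ z ≠ 1
      have hb : ‖η⁻¹ * Φ z‖ < 1 := by
        rw [hΦψ z hz, norm_mul, norm_inv, hη1, inv_one, one_mul]
        exact mem_ball_zero_iff.1 (ψ.mapsTo hz)
      intro h
      rw [h, norm_one] at hb
      exact lt_irrefl _ hb
    · exact hwne t (hne t ht)
  · -- real boundary values `w₀ (∂Ω(t)) = g t`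
    change cayleyInvFun (w t) = ((cayleyInvFun (w t)).re : ℂ)
    exact cayleyInvFun_eq_ofReal_re (hw1 t)

end Summit.CriticalPhenomena.CardyFormulaZ2.Cruxes.RectilinearCardy.ExcursionKernelCovariance
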